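import Mathlib
import HarnessLib

/-!
# Format C / A′ (joint phantom ripples): Gram (sum-of-squares) positivity of trigonometric polynomials on a torus

Helper file (`--supports stmt-RiemannHypothesis-0098`, lead-track anchor; infrastructure for the
Weil-positivity window ladder), RH-free.  Seat rh-explicit-weil-3 (structure seat; memo
`run/shared/lean/pub/rh-explicit/WEIL3-STRUCTURE.md` §9.5, kernel route K2).

A JOINT phantom ripple `P(t) = Σ_v c_v cos(t⟨v, ℓ⟩)` (`ℓ = (log p)_p`, integer vectors `v` with
`|⟨v, ℓ⟩| ≥ 2a`) lowers the far/level constant of a Weil-positivity certificate from the pointwise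
`Σ 2Λ(n)/√n` to `D = sup_t (P₀ − P)(t)`; by Kronecker's theorem the supremum is the maximum over the torus
`T^k` of the trigonometric polynomial `F(θ) = P₀(θ) − P(θ)`, so the certificate needs `D − F ≥ 0` on `T^k`.
The kernel-cheap way (one `LDLᵀ`, `Literature.Analysis.ValidatedNumerics.PSDCert`) is a GRAM / SOS
representation: with monomials `m_β(θ) = e^{i⟨A_β, θ⟩}` (`A_β ∈ ℤ^k`, `β` in a finite index type) and a positive
semidefinite matrix `Q`,
  `m(θ)ᴴ Q m(θ) = Σ_{α,β} Q_{αβ} e^{i⟨A_β − A_α, θ⟩} ≥ 0`   for every `θ ∈ ℝ^k`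
(`re_torusGram_nonneg`, `im_torusGram_eq_zero`), and a trigonometric polynomial whose coefficients MATCH
those of `mᴴQm` frequency by frequency is that function (`torusPoly_eq_torusGram_of_coeff_match`), hence
nonnegative (`re_torusPoly_nonneg_of_coeff_match`).  Existence of such `Q` for STRICTLY positive
trigonometric polynomials in several variables is Dritschel's theorem (M. A. Dritschel, *On factorization of
trigonometric polynomials*, Integral Equations Operator Theory 49 (2004) 11–42); finding `Q` is an off-line
SDP; here only the (elementary) soundness direction is proved.  No definitions, no facts.
-/

set_option linter.dupNamespace false

noncomputable section

open Complex Matrix Finset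
open scoped ComplexOrder ComplexConjugate BigOperators

namespace Summit.RiemannHypothesis.RiemannHypothesis.Theorems.WeilFormatC

variable {k : ℕ} {ι : Type*} [Fintype ι]

/-- `conj(e^{i⟨A,θ⟩}) e^{i⟨B,θ⟩} = e^{i⟨B−A,θ⟩}` for integer frequency vectors. [folklore] -/
private lemma conj_cexp_phase_mul_cexp_phase (A B : Fin k → ℤ) (θ : Fin k → ℝ) :
    conj (cexp (I * ((∑ j, (A j : ℝ) * θ j : ℝ) : ℂ))) * cexp (I * ((∑ j, (B j : ℝ) * θ j : ℝ) : ℂ)) =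
      cexp (I * ((∑ j, ((B j - A j : ℤ) : ℝ) * θ j : ℝ) : ℂ)) := by
  rw [← Complex.exp_conj, ← Complex.exp_add]
  congr 1
  have e : (∑ j, ((B j - A j : ℤ) : ℝ) * θ j : ℝ) = (∑ j, (B j : ℝ) * θ j) - ∑ j, (A j : ℝ) * θ j := by
    rw [← Finset.sum_sub_distrib]
    refine Finset.sum_congr rfl fun j _ ↦ ?_
    push_cast; ring
  rw [e]
  simp only [map_mul, Complex.conj_I, Complex.conj_ofReal]
  push_cast
  ring

/-- The Gram form `mᴴ Q m` of the torus monomials equals the double exponential sum. [folklore] -/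
private lemma star_dotProduct_mulVec_torusMonomials (A : ι → Fin k → ℤ) (Q : Matrix ι ι ℂ) (θ : Fin k → ℝ) :
    star (fun β ↦ cexp (I * ((∑ j, (A β j : ℝ) * θ j : ℝ) : ℂ))) ⬝ᵥ
        Q *ᵥ (fun β ↦ cexp (I * ((∑ j, (A β j : ℝ) * θ j : ℝ) : ℂ))) =
      ∑ α, ∑ β, Q α β * cexp (I * ((∑ j, ((A β j - A α j : ℤ) : ℝ) * θ j : ℝ) : ℂ)) := by
  simp only [dotProduct, mulVec, Pi.star_apply, Finset.mul_sum]
  refine Finset.sum_congr rfl fun α _ ↦ Finset.sum_congr rfl fun β _ ↦ ?_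
  have h := conj_cexp_phase_mul_cexp_phase (A α) (A β) θ
  rw [Complex.star_def, show conj (cexp (I * ((∑ j, (A α j : ℝ) * θ j : ℝ) : ℂ))) *
      (Q α β * cexp (I * ((∑ j, (A β j : ℝ) * θ j : ℝ) : ℂ))) =
      Q α β * (conj (cexp (I * ((∑ j, (A α j : ℝ) * θ j : ℝ) : ℂ))) *
        cexp (I * ((∑ j, (A β j : ℝ) * θ j : ℝ) : ℂ))) by ring, h]

/-- **Gram positivity on the torus (real part).**  For a positive semidefinite `Q` and integer frequency
vectors `A_β`, `Re Σ_{α,β} Q_{αβ} e^{i⟨A_β − A_α, θ⟩} ≥ 0` for every `θ` — it is `m(θ)ᴴ Q m(θ)` with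
`m_β = e^{i⟨A_β,θ⟩}`. [folklore; the soundness half of Dritschel 2004 / Fejér–Riesz-type SOS certificates] -/
theorem re_torusGram_nonneg (A : ι → Fin k → ℤ) {Q : Matrix ι ι ℂ} (hQ : Q.PosSemidef) (θ : Fin k → ℝ) :
    0 ≤ (∑ α, ∑ β, Q α β *
      cexp (I * ((∑ j, ((A β j - A α j : ℤ) : ℝ) * θ j : ℝ) : ℂ))).re := by
  have hq := hQ.re_dotProduct_nonneg (fun β ↦ cexp (I * ((∑ j, (A β j : ℝ) * θ j : ℝ) : ℂ)))
  rw [star_dotProduct_mulVec_torusMonomials A Q θ] at hq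
  simpa using hq

/-- **Gram positivity on the torus (the value is real).**  `Im Σ_{α,β} Q_{αβ} e^{i⟨A_β − A_α, θ⟩} = 0` for a
positive semidefinite (hence Hermitian) `Q`. [folklore] -/
theorem im_torusGram_eq_zero (A : ι → Fin k → ℤ) {Q : Matrix ι ι ℂ} (hQ : Q.PosSemidef) (θ : Fin k → ℝ) :
    (∑ α, ∑ β, Q α β *
      cexp (I * ((∑ j, ((A β j - A α j : ℤ) : ℝ) * θ j : ℝ) : ℂ))).im = 0 := by
  have hq : 0 ≤ star (fun β ↦ cexp (I * ((∑ j, (A β j : ℝ) * θ j : ℝ) : ℂ))) ⬝ᵥ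
      Q *ᵥ (fun β ↦ cexp (I * ((∑ j, (A β j : ℝ) * θ j : ℝ) : ℂ))) := hQ.dotProduct_mulVec_nonneg _
  rw [star_dotProduct_mulVec_torusMonomials A Q θ] at hq
  exact ((Complex.nonneg_iff.mp hq).2).symm

/-- **Coefficient matching.**  If a finitely supported coefficient function `f` on `ℤ^k` (support inside the
finite set `Γ`, which contains every difference `A_β − A_α`) satisfies
`f γ = Σ_{α,β : A_β − A_α = γ} Q_{αβ}` for all `γ ∈ Γ`, then the trigonometric polynomial
`Σ_{γ∈Γ} f_γ e^{i⟨γ,θ⟩}` IS the Gram form `Σ_{α,β} Q_{αβ} e^{i⟨A_β − A_α,θ⟩}`. [folklore] -/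
theorem torusPoly_eq_torusGram_of_coeff_match (A : ι → Fin k → ℤ) (Q : Matrix ι ι ℂ)
    (Γ : Finset (Fin k → ℤ)) (hΓ : ∀ α β, A β - A α ∈ Γ) (f : (Fin k → ℤ) → ℂ)
    (hf : ∀ γ ∈ Γ, f γ = ∑ α, ∑ β, if A β - A α = γ then Q α β else 0) (θ : Fin k → ℝ) :
    ∑ γ ∈ Γ, f γ * cexp (I * ((∑ j, ((γ j : ℤ) : ℝ) * θ j : ℝ) : ℂ)) =
      ∑ α, ∑ β, Q α β * cexp (I * ((∑ j, ((A β j - A α j : ℤ) : ℝ) * θ j : ℝ) : ℂ)) := by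
  -- expand `f` and exchange the sums
  have h1 : ∑ γ ∈ Γ, f γ * cexp (I * ((∑ j, ((γ j : ℤ) : ℝ) * θ j : ℝ) : ℂ)) =
      ∑ γ ∈ Γ, ∑ α, ∑ β, (if A β - A α = γ then Q α β else 0) *
        cexp (I * ((∑ j, ((γ j : ℤ) : ℝ) * θ j : ℝ) : ℂ)) := by
    refine Finset.sum_congr rfl fun γ hγ ↦ ?_
    rw [hf γ hγ, Finset.sum_mul]
    refine Finset.sum_congr rfl fun α _ ↦ ?_
    rw [Finset.sum_mul]
  rw [h1, Finset.sum_comm]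
  refine Finset.sum_congr rfl fun α _ ↦ ?_
  rw [Finset.sum_comm]
  refine Finset.sum_congr rfl fun β _ ↦ ?_
  -- only `γ = A β − A α` survives
  rw [Finset.sum_eq_single (A β - A α)]
  · rw [if_pos rfl]
    congr 3
  · intro γ _ hne
    rw [if_neg (Ne.symm hne), zero_mul]
  · intro h
    exact absurd (hΓ α β) h

/-- **SOS certificate soundness on the torus.**  Under the coefficient-matching hypothesis of
`torusPoly_eq_torusGram_of_coeff_match` with `Q` positive semidefinite, the trigonometric polynomial
`Σ_{γ∈Γ} f_γ e^{i⟨γ,θ⟩}` has nonnegative real part (and zero imaginary part) at every `θ ∈ ℝ^k` — the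
statement a joint-phantom level / far-bound certificate consumes with `f` = the coefficients of
`D − P₀ + P`. [folklore; soundness half of Dritschel 2004] -/
theorem re_torusPoly_nonneg_of_coeff_match (A : ι → Fin k → ℤ) {Q : Matrix ι ι ℂ} (hQ : Q.PosSemidef)
    (Γ : Finset (Fin k → ℤ)) (hΓ : ∀ α β, A β - A α ∈ Γ) (f : (Fin k → ℤ) → ℂ)
    (hf : ∀ γ ∈ Γ, f γ = ∑ α, ∑ β, if A β - A α = γ then Q α β else 0) (θ : Fin k → ℝ) :
    0 ≤ (∑ γ ∈ Γ, f γ * cexp (I * ((∑ j, ((γ j : ℤ) : ℝ) * θ j : ℝ) : ℂ))).re ∧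
      (∑ γ ∈ Γ, f γ * cexp (I * ((∑ j, ((γ j : ℤ) : ℝ) * θ j : ℝ) : ℂ))).im = 0 := by
  rw [torusPoly_eq_torusGram_of_coeff_match A Q Γ hΓ f hf θ]
  exact ⟨re_torusGram_nonneg A hQ θ, im_torusGram_eq_zero A hQ θ⟩

/-! ### Cosine form (the data format of a phantom level certificate) -/

/-- For REAL coefficients `f_γ`, the real part of `Σ_γ f_γ e^{i⟨γ,θ⟩}` is the cosine polynomial
`Σ_γ f_γ cos⟨γ,θ⟩`. [folklore] -/
theorem re_torusPoly_eq_cosPoly (Γ : Finset (Fin k → ℤ)) (f : (Fin k → ℤ) → ℝ) (θ : Fin k → ℝ) :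
    (∑ γ ∈ Γ, ((f γ : ℝ) : ℂ) * cexp (I * ((∑ j, ((γ j : ℤ) : ℝ) * θ j : ℝ) : ℂ))).re =
      ∑ γ ∈ Γ, f γ * Real.cos (∑ j, ((γ j : ℤ) : ℝ) * θ j) := by
  rw [Complex.re_sum]
  refine Finset.sum_congr rfl fun γ _ ↦ ?_
  rw [mul_comm I, Complex.re_ofReal_mul, Complex.exp_ofReal_mul_I_re]

/-- **Cosine-polynomial SOS certificate on the torus.**  Let `f : ℤ^k → ℝ` be real coefficients on a finite
frequency set `Γ` containing all differences `A_β − A_α` of the Gram monomials, and `Q ⪰ 0` a complex Gram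
matrix with `f γ = Σ_{A_β − A_α = γ} Q_{αβ}` (as complex numbers) for `γ ∈ Γ`.  Then
`0 ≤ Σ_{γ∈Γ} f_γ cos⟨γ, θ⟩` for every `θ ∈ ℝ^k`.  With `f` = the coefficients of `D − P₀ + P`
(symmetrised: `f_γ = f_{−γ} = ½·coefficient of cos⟨γ,·⟩`, `f_0 = D`) this is the joint-phantom level / far-bound
inequality `P₀(θ) − P(θ) ≤ D` on the whole torus, hence `sup_t (P₀ − P)(t) ≤ D` by restriction to the line
`θ = t·(log p)_p`. [folklore; soundness half of Dritschel 2004] -/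
theorem cosPoly_nonneg_of_coeff_match (A : ι → Fin k → ℤ) {Q : Matrix ι ι ℂ} (hQ : Q.PosSemidef)
    (Γ : Finset (Fin k → ℤ)) (hΓ : ∀ α β, A β - A α ∈ Γ) (f : (Fin k → ℤ) → ℝ)
    (hf : ∀ γ ∈ Γ, ((f γ : ℝ) : ℂ) = ∑ α, ∑ β, if A β - A α = γ then Q α β else 0) (θ : Fin k → ℝ) :
    0 ≤ ∑ γ ∈ Γ, f γ * Real.cos (∑ j, ((γ j : ℤ) : ℝ) * θ j) := by
  have h := (re_torusPoly_nonneg_of_coeff_match A hQ Γ hΓ (fun γ ↦ ((f γ : ℝ) : ℂ)) hf θ).1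
  rwa [re_torusPoly_eq_cosPoly] at h

end Summit.RiemannHypothesis.RiemannHypothesis.Theorems.WeilFormatC
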